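import Summits.ABC.IUTFork.Cor312MultiradTwist
import Summits.ABC.IUTFork.Thm311MultiradProofs
import HarnessLib

/-!
# [IUTchIII] Cor. 3.12, verbatim form — the q-side twist: the pilot asymmetry is volume-immaterial

Record-only file (D-0012) of the abc-iut cell (D-0067 Cor. 3.12 strategy TEAM C «étale-picture /
multiradiality», seat abc-iut-c312-13, row C-7 of `HOME/plan/C312-TEAMS.md`); TAKES NO SIDE. The statement
of Cor. 3.12 (kurims `paper:url-4b091feeb646` p. 174 l. 8–10) exempts the q-pilot image from the
indeterminacies: its Θ-side quantity is read "subject to (Ind1), (Ind2), (Ind3)", its q-side quantity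
"which we do *not* regard as subject to" them. This file isolates exactly how much work that asymmetry
does at the level of the two NUMBERS, by twisting the q-side Kummer glue `qRegionOf` by a family
`Φ₀ ∈ indGroup S` — the dual of the Θ-side twist of `Cor312MultiradTwist.lean` (row C-1):

* the Θ-side quantity does not move at all (`qTwistGlue_negLogTheta` — the Θ-data never reads the q-glue;
  the same independence c312-4's `SheMeansFixedValueReal` records at (xi-e));
* the q-side quantity moves only through the log-volume of the twisted image
  (`qTwistGlue_negLogQ_of_logvol`); in particular, under the (Ind1)(Ind2) volume invariance that Step (x)
  itself asserts ("the procession-normalized mono-analytic log-volume … is invariant with respect to the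
  indeterminacies (Ind1), (Ind2)", p. 181 l. 2–5; typed `MRData.LogvolInvariant` + admissibility
  transport, propagated to the generated group by L6-t13's `adm_and_logvol_eq_of_mem_closure`), the
  q-side quantity and the whole `Statement` are UNCHANGED by the q-twist
  (`qTwistGlue_statement_iff_of_invariance`).

Together with row C-1 (`twistGlue_statement_iff`: the Θ-side twist changes nothing, with NO volume
hypothesis), this is the kernel form of: **once the volume invariance of Step (x) is granted, the
statement's exemption of the q-pilot from (Ind1), (Ind2) does no work at the volume level — both printed
quantities are invariant under re-choosing either Kummer identification within the indeterminacy orbit.**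
What the exemption DOES govern is the SET-level reading of Step (xi-f) (which possible image the q-region
is measured against) — the one node where the set-level identification enters
(`Cor312EtaleLedger.setLevel_only_at_xi_f`, row C-2), the input the types do not force (c312-4
`mainGoal_is_the_extra_input`; skel `ForkInd1Passive.setLevel_forces_active`). Nothing here asserts
Cor. 3.12; the twisted setting is bookkeeping, not a claim that the glue IS so twisted.
[claim: Mochizuki2012, status: disputed] for the quoted clauses; bookkeeping proofs are [folklore].
Deliberately NOT here: discharge of the volume-invariance hypotheses on the real containers (Team B row
B-2, landed separately); the identified-copies reading (Team R); any judgement.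
-/

noncomputable section

namespace Summit.ABC.IUTFork.Cor312

open Thm311 Literature.IUT.LogThetaLattice

namespace Setting

variable {T : ThetaIndex} {S : Situation T} (P : Setting S)

/-- The setting whose q-side Kummer glue is POST-COMPOSED by a family `Φ₀` of packet automorphisms — the
dual of `twistGlue` (which twists the Θ-side glue). The two proof obligations of the twisted setting are
taken as inputs: `hmem` (the twisted q-pilot image is still a hull-set — on the real containers this is
the lattice-stability of the hull-sets under the indeterminacy families) and `hfin` (finite support of
the twisted q-volumes — derivable from volume invariance, `qSupport_finite_of_invariance` below).
[claim: Mochizuki2012, status: disputed] -/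
def qTwistGlue (Φ₀ : S.L.PacketAut)
    (hmem : ∀ (j : T.Label) (vQ : T.VQ),
      Φ₀ j vQ '' P.qRegionOf (qPilotObject P.qData) j vQ ∈ (P.frame j vQ).Hul)
    (hfin : ∀ j : T.Label, (Function.support fun vQ =>
      (S.D P.n).logvol j vQ (Φ₀ j vQ '' P.qRegionOf (qPilotObject P.qData) j vQ)).Finite) :
    Setting S :=
  { P with
    qRegionOf := fun ob j vQ => Φ₀ j vQ '' P.qRegionOf ob j vQ
    qRegion_mem := hmem
    qSupport_finite := hfin }

section QTwist

variable (Φ₀ : S.L.PacketAut)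
  (hmem : ∀ (j : T.Label) (vQ : T.VQ),
    Φ₀ j vQ '' P.qRegionOf (qPilotObject P.qData) j vQ ∈ (P.frame j vQ).Hul)
  (hfin : ∀ j : T.Label, (Function.support fun vQ =>
    (S.D P.n).logvol j vQ (Φ₀ j vQ '' P.qRegionOf (qPilotObject P.qData) j vQ)).Finite)

/-- The q-twist keeps the column. [folklore] -/
theorem qTwistGlue_n : (P.qTwistGlue Φ₀ hmem hfin).n = P.n := rfl

/-- The twisted q-pilot image is the `Φ₀`-translate. [folklore] -/
theorem qTwistGlue_qRegion (j : T.Label) (vQ : T.VQ) :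
    (P.qTwistGlue Φ₀ hmem hfin).qRegion j vQ = Φ₀ j vQ '' P.qRegion j vQ := rfl

/-- The q-twist does not move the Θ-side data: same possible images. [folklore] -/
theorem qTwistGlue_possibleImages (j : T.Label) (vQ : T.VQ) :
    (P.qTwistGlue Φ₀ hmem hfin).possibleImages j vQ = P.possibleImages j vQ := rfl

/-- **The Θ-side quantity never reads the q-glue**: `−|log(Θ)|` is unchanged by the q-twist — with no
hypothesis at all (cf. c312-4's `SheMeansFixedValueReal`, the (xi-e) independence). [folklore] -/
theorem qTwistGlue_negLogTheta : (P.qTwistGlue Φ₀ hmem hfin).negLogTheta = P.negLogTheta :=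
  negLogTheta_congr P (P.qTwistGlue Φ₀ hmem hfin) rfl (fun _ _ => rfl) fun _ _ => rfl

/-- The q-side quantity moves only through the log-volume of the twisted image: if the twisted image has
the volume of the original at every `(j, v_ℚ)`, `−|log(q)|` is unchanged. [folklore] -/
theorem qTwistGlue_negLogQ_of_logvol
    (hvol : ∀ (j : T.Label) (vQ : T.VQ),
      (S.D P.n).logvol j vQ (Φ₀ j vQ '' P.qRegion j vQ) = (S.D P.n).logvol j vQ (P.qRegion j vQ)) :
    (P.qTwistGlue Φ₀ hmem hfin).negLogQ = P.negLogQ := by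
  unfold negLogQ qLocal
  congr 1
  funext i
  refine finsum_congr fun vQ => ?_
  show (S.D P.n).logvol (labelSucc i) vQ (Φ₀ (labelSucc i) vQ '' P.qRegion (labelSucc i) vQ) =
    (S.D P.n).logvol (labelSucc i) vQ (P.qRegion (labelSucc i) vQ)
  exact hvol (labelSucc i) vQ

/-- Under the same pointwise volume equality, the printed conclusion is q-twist-invariant. [folklore] -/
theorem qTwistGlue_statement_iff_of_logvol
    (hvol : ∀ (j : T.Label) (vQ : T.VQ),
      (S.D P.n).logvol j vQ (Φ₀ j vQ '' P.qRegion j vQ) = (S.D P.n).logvol j vQ (P.qRegion j vQ)) :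
    (P.qTwistGlue Φ₀ hmem hfin).Statement ↔ P.Statement := by
  unfold Statement
  rw [P.qTwistGlue_negLogTheta Φ₀ hmem hfin, P.qTwistGlue_negLogQ_of_logvol Φ₀ hmem hfin hvol]

/-! ## The volume equality from the (Ind1)(Ind2) invariance of Step (x) -/

/-- The q-pilot image is an admissible region (it is a hull-set, `qRegion_mem`, and hull-sets are
admissible, `hul_adm`). [folklore] -/
theorem qRegion_adm (j : T.Label) (vQ : T.VQ) : (S.D P.n).Adm j vQ (P.qRegion j vQ) :=
  P.hul_adm j vQ _ (P.qRegion_mem j vQ)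

/-- Under generator-level admissibility transport and `MRData.LogvolInvariant` (Step (x)'s "invariant
with respect to the indeterminacies (Ind1), (Ind2)", p. 181 l. 2–5), every `Φ₀ ∈ indGroup S` preserves
the log-volume of the q-pilot image — via L6-t13's closure propagation
(`MRData.adm_and_logvol_eq_of_mem_closure`). [folklore] -/
theorem logvol_image_qRegion_eq_of_invariance
    (hAdm : ∀ Φ ∈ S.L.Ind1Family ∪ S.L.Ind2Family, ∀ (j : T.Label) (vQ : T.VQ)
      (A : Set (S.L.Packet j vQ)), (S.D P.n).Adm j vQ A ↔ (S.D P.n).Adm j vQ (Φ j vQ '' A))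
    (hvol : (S.D P.n).LogvolInvariant) (hΦ₀ : Φ₀ ∈ indGroup S) (j : T.Label) (vQ : T.VQ) :
    (S.D P.n).logvol j vQ (Φ₀ j vQ '' P.qRegion j vQ) = (S.D P.n).logvol j vQ (P.qRegion j vQ) :=
  ((S.D P.n).adm_and_logvol_eq_of_mem_closure hAdm hvol hΦ₀ j vQ _ (P.qRegion_adm j vQ)).2

/-- Under the same invariance hypotheses, the support-finiteness obligation of the twisted setting is
DERIVABLE from `P`'s (so only the hull-set membership `hmem` is a genuine extra input). [folklore] -/
theorem qSupport_finite_of_invariance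
    (hAdm : ∀ Φ ∈ S.L.Ind1Family ∪ S.L.Ind2Family, ∀ (j : T.Label) (vQ : T.VQ)
      (A : Set (S.L.Packet j vQ)), (S.D P.n).Adm j vQ A ↔ (S.D P.n).Adm j vQ (Φ j vQ '' A))
    (hvol : (S.D P.n).LogvolInvariant) (hΦ₀ : Φ₀ ∈ indGroup S) (j : T.Label) :
    (Function.support fun vQ =>
      (S.D P.n).logvol j vQ (Φ₀ j vQ '' P.qRegionOf (qPilotObject P.qData) j vQ)).Finite := by
  have h : (Function.support fun vQ =>
      (S.D P.n).logvol j vQ (Φ₀ j vQ '' P.qRegionOf (qPilotObject P.qData) j vQ)) =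
      Function.support fun vQ => (S.D P.n).logvol j vQ (P.qRegionOf (qPilotObject P.qData) j vQ) := by
    apply congrArg
    funext vQ
    exact P.logvol_image_qRegion_eq_of_invariance Φ₀ hAdm hvol hΦ₀ j vQ
  rw [h]
  exact P.qSupport_finite j

/-- **THE PILOT ASYMMETRY IS VOLUME-IMMATERIAL**: granting Step (x)'s (Ind1)(Ind2) volume invariance (in
the generator form Team B discharges on the real containers), the printed conclusion of Cor. 3.12 is
invariant under twisting the q-side Kummer glue by any element of the indeterminacy group — exactly as it
is invariant under twisting the Θ-side glue with no hypothesis at all (`twistGlue_statement_iff`, row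
C-1). The statement's exemption of the q-pilot from (Ind1), (Ind2) therefore does no work at the level of
the two numbers; its work is confined to the SET-level reading of Step (xi-f)
(`Cor312EtaleLedger.setLevel_only_at_xi_f`). [folklore] -/
theorem qTwistGlue_statement_iff_of_invariance
    (hAdm : ∀ Φ ∈ S.L.Ind1Family ∪ S.L.Ind2Family, ∀ (j : T.Label) (vQ : T.VQ)
      (A : Set (S.L.Packet j vQ)), (S.D P.n).Adm j vQ A ↔ (S.D P.n).Adm j vQ (Φ j vQ '' A))
    (hvol : (S.D P.n).LogvolInvariant) (hΦ₀ : Φ₀ ∈ indGroup S) :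
    (P.qTwistGlue Φ₀ hmem hfin).Statement ↔ P.Statement :=
  P.qTwistGlue_statement_iff_of_logvol Φ₀ hmem hfin
    (P.logvol_image_qRegion_eq_of_invariance Φ₀ hAdm hvol hΦ₀)

end QTwist

end Setting

end Summit.ABC.IUTFork.Cor312

end
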